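import Literature.NumberTheory.DiophantineGeometry.AVIsogenyTateHomCubeProofs
import Literature.AlgebraicGeometry.Motives.AbelianVarietyKernelComponent
import HarnessLib

/-!
# `Hom(A, B)` finitely generated (Mumford §19, Theorem 3): the trust base reduced to the theorem of
# the cube and Poincaré reducibility

Seventh part of the proof files for the named fact
`Literature.AlgebraicGeometry.Motives.AbelianVariety.module_finite_hom` of `AVIsogenyTate`
(`Hom(A, B)` is finitely generated; Mumford, *Abelian Varieties*, §19, Theorem 3; Milne 1986,
Theorem 12.5).

`AVIsogenyTateHomCubeProofs` proves Theorem 3 for all `A`, `B` over any field `K` from the Theorem of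
the Cube (the named fact `theoremOfCube_linEquiv`, Görtz–Wedhorn II Thm. 24.73) and two geometric
inputs over the algebraic closure `K̄`: Poincaré's complete reducibility theorem (§19 Thm. 1,
hypothesis `hP1`) and "a non-zero homomorphism between simple abelian varieties is an isogeny"
(§19 Cor. 2 of Thm. 1, hypothesis `hsimple`). The latter is now a **theorem** over algebraically
closed fields (`Motives/AbelianVarietyKernelComponent.hsimple_of_isAlgClosed`: images of
homomorphisms and the identity component of the kernel are abelian subvarieties), so here:

* `AbelianVariety.module_finite_hom_of_theoremOfCube_of_poincare_algebraicClosure` — Mumford §19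
  Thm. 3 for all `A`, `B` over `K` from the Theorem of the Cube and Poincaré reducibility over `K̄`.

So the named fact `module_finite_hom` now rests on exactly: the theorem of the cube (coherent
cohomology and base change) and Poincaré's complete reducibility theorem over `K̄` (§19 Thm. 1:
duals / `Pic⁰`, or Mumford §8 Thm. 1 with the seesaw theorem).

## References

* [MumfordAV1970] D. Mumford, *Abelian Varieties*, §19, Thm. 1 with Cor. 1–2 (pp. 173–174 of the
  2nd ed.), Thm. 3 and its proof (pp. 176–178). Not held; architecture as in Milne 1986.
* [Milne1986AbelianVarieties] J. S. Milne, *Abelian Varieties*, in Cornell–Silverman (eds.),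
  *Arithmetic Geometry*, Springer 1986, §12, Prop. 12.1, Thm. 12.5 (held:
  `book:cornellnd-arithmetic-geometry`, PDF pp. 189–191).

## Design

No definitions, no named facts; a one-line composition.
-/

universe u

open CategoryTheory CategoryTheory.Limits AlgebraicGeometry

noncomputable section

namespace Literature.NumberTheory.DiophantineGeometry

section AbelianVariety
open Literature.AlgebraicGeometry.Motives (AbelianVariety theoremOfCube_linEquiv)
open Literature.AlgebraicGeometry.Motives.AbelianVariety

variable {K : Type u} [Field K]

/-- **Mumford §19 Theorem 3 over an arbitrary field from the Theorem of the Cube and Poincaré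
reducibility over the algebraic closure.** If Poincaré's complete reducibility theorem (§19 Thm. 1)
holds for abelian varieties over `K̄`, then `Hom_K(A, B)` is a finitely generated group for all
abelian varieties `A`, `B` over `K` — "simple ⇒ isogeny" (§19 Cor. 2 of Thm. 1) over `K̄` being
`hsimple_of_isAlgClosed`. [cite: MumfordAV1970, §19 Thm. 3 (pp. 176–178)] -/
theorem _root_.Literature.AlgebraicGeometry.Motives.AbelianVariety.module_finite_hom_of_theoremOfCube_of_poincare_algebraicClosure
    (hcube : theoremOfCube_linEquiv.{u})
    (hP1 : ∀ (X Y : AbelianVariety (AlgebraicClosure K)) (i : Y ⟶ X),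
      IsClosedImmersion (Hom.toSchemeHom i) → 0 < Y.dim → Y.dim < X.dim →
      ∃ (Z : AbelianVariety (AlgebraicClosure K)) (j : Z ⟶ X),
        IsClosedImmersion (Hom.toSchemeHom j) ∧ IsIsogeny (biprod.desc i j))
    (A B : AbelianVariety K) : module_finite_hom A B :=
  module_finite_hom_of_theoremOfCube_of_algebraicClosure hcube hP1
    (hsimple_of_isAlgClosed (AlgebraicClosure K)) A B

end AbelianVariety

end Literature.NumberTheory.DiophantineGeometry
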